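import Mathlib
import Summits.NavierStokesRegularity.NavierStokesRegularity.Theorems.EulerZoomLiouvillePowerGaugeEulerLiouvilleDSSEtaRatchet
import Literature.Analysis.FluidPDE.AxisymNoSwirlScaleInvariantBounds
import Literature.Analysis.FluidPDE.AxisymHouLiVariables
import HarnessLib

/-!
# Crux E `PowerGaugeEulerLiouville` (stmt-NavierStokesRegularity-19832): the one-slice axisymmetric DSS stratum with the `η`-clause replaced by
# A BOUNDED VORTICITY GRADIENT ON ONE SLICE (width seat ns-ezl-w3 g3)

Route №10 `EulerZoomLiouville` (NavierStokesRegularity), crux E; LEAD ns-typeII-p2 g12; fourth file of the discrete-ratchet chain (`…DSSSwirlRatchet` p644925,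
`…DSSSwirlCasimir` p646151, `…DSSEtaRatchet`).  The `η`-clause of `DSSEtaRatchet.ae_eq_zero_of_gauge_of_axisym_dss_oneSlice` (`η = ω_θ/r` bounded, or of finite
support, or in one `L^q` off `q(3+ρ) = 3`, on one slice) is implied by an honest derivative bound: for a swirl-free axisymmetric `v ∈ C³` the vorticity is purely
azimuthal, `‖curl v(x)‖ = r(x) · |η(x)|` (tree: `norm_curl_eq_cylRadius_mul_abs_angVortQuot`), so it VANISHES ON THE AXIS and the mean value inequality gives
`r|η(x)| = ‖curl v(x) − curl v(x_axis)‖ ≤ ‖D curl v‖_∞ · r`, i.e. **`|η| ≤ ‖D curl v‖_∞` everywhere** (`abs_angVortQuot_le_of_norm_fderiv_curl_le`; the axis itself by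
continuity of `η`).  Member form `ae_eq_zero_of_gauge_of_axisym_dss_vorticityGradient`: classical axisymmetric `l`-DSS member, `u`/`∇u` bounded on compact past
intervals, and on ONE slice `τ₀ < 0` a swirl clause (`|r u_θ| ≤ B` ∨ `vol{r u_θ ≠ 0} < ⊤` ∨ `∫⁻|r u_θ|^q < ⊤`, `q > 0`, `qρ ≠ 3`) AND `‖∇ω(τ₀,·)‖ ≤ B₂` ⇒ `u = 0` a.e.
For the LEAD: the axisymmetric alternative of `IsDSSClassicalTame` may read «… ∧ ∃ τ₀ < 0, swirl-clause(τ₀) ∧ ∃ B₂, ∀ y, ‖fderiv ℝ (curl (u τ₀)) y‖ ≤ B₂».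

WHAT THIS IS NOT: not NS regularity, not the crux E — a widening of one DSS stratum of the crux CLASS 19832 (MODEL lattice; E/NS strata) `--supports` stmt-19832;
19832 OPEN. [folklore; KochNadirashviliSereginSverak2009 §5 Remark 5.1 (`ω = ω_θ e_θ`, `ω_θ/r` smooth); MajdaBertozziCUP2002 §4.3 (4.60)]
-/

noncomputable section

-- flat `Theorems/<Route><Decl>…` files of one crux share the namespace of the crux (tree convention: `Summit.<S>.<S>.…`)
set_option linter.dupNamespace false

open MeasureTheory Set Filter Topology Metric Function InnerProductSpace
open scoped RealInnerProductSpace NNReal ENNReal ContDiff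

namespace Summit.NavierStokesRegularity.NavierStokesRegularity.Theorems.PowerGaugeEulerLiouville

open Literature.Analysis Literature.Analysis.FluidPDE Literature.Analysis.FunctionSpaces

namespace DSSEtaRatchet

/-- **`|ω_θ/r| ≤ ‖∇ω‖_∞` for a swirl-free axisymmetric `C³` field**: the vorticity is azimuthal, `‖curl v(x)‖ = r(x)|η(x)|`, vanishes on the axis, and the mean
value inequality along the horizontal segment to the axis bounds it by `‖D curl v‖_∞ · r(x)`; on the axis by continuity of `η`.
[cite: KochNadirashviliSereginSverak2009, §5 Remark 5.1] -/
theorem abs_angVortQuot_le_of_norm_fderiv_curl_le {v : EuclideanSpace ℝ (Fin 3) → EuclideanSpace ℝ (Fin 3)}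
    (hax : IsAxisymmetric v) (hsw : HasNoSwirl v) (hv : ContDiff ℝ 3 v) {B : ℝ}
    (hB : ∀ y, ‖fderiv ℝ (curl v) y‖ ≤ B) (x : EuclideanSpace ℝ (Fin 3)) : |angVortQuot v x| ≤ B := by
  have hωd : Differentiable ℝ (curl v) := (contDiff_curl (n := 2) (by exact_mod_cast hv)).differentiable (by norm_num)
  have hcont : Continuous (angVortQuot v) := (contDiff_angVortQuot (n := 0) (by exact_mod_cast hv)).continuous
  -- off the axis
  have hoff : ∀ z : EuclideanSpace ℝ (Fin 3), cylRadius z ≠ 0 → |angVortQuot v z| ≤ B := by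
    intro z hz
    have hr : 0 < cylRadius z := lt_of_le_of_ne (cylRadius_nonneg z) (Ne.symm hz)
    set a : EuclideanSpace ℝ (Fin 3) := EuclideanSpace.single 2 (z 2) with ha
    have ha0 : cylRadius a = 0 := by
      rw [cylRadius_eq_zero_iff]; simp [ha]
    have hωa : curl v a = 0 := by
      have h := norm_curl_eq_cylRadius_mul_abs_angVortQuot hax hsw hv a
      rw [ha0, zero_mul] at h
      exact norm_eq_zero.1 h
    have hmv : ‖curl v z - curl v a‖ ≤ B * ‖z - a‖ :=
      (convex_univ).norm_image_sub_le_of_norm_fderiv_le (fun y _ => hωd.differentiableAt) (fun y _ => hB y) (mem_univ a) (mem_univ z)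
    -- `‖z − (0,0,z₂)‖ = r(z)` (the tree's `NeedleCasimirClock.norm_sub_axisProj_eq_cylRadius`, inlined to keep the import cone small)
    have hdist : ‖z - EuclideanSpace.single 2 (z 2)‖ = cylRadius z := by
      rw [EuclideanSpace.norm_eq, cylRadius, Fin.sum_univ_three]
      congr 1
      simp [Real.norm_eq_abs, sq_abs]
    rw [hωa, sub_zero, norm_curl_eq_cylRadius_mul_abs_angVortQuot hax hsw hv z, ha, hdist, mul_comm] at hmv
    exact le_of_mul_le_mul_right hmv hr
  -- on the axis: approach along `e₀`
  by_cases hx : cylRadius x ≠ 0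
  · exact hoff x hx
  · rw [not_ne_iff, cylRadius_eq_zero_iff] at hx
    set xs : ℕ → EuclideanSpace ℝ (Fin 3) := fun n => x + EuclideanSpace.single 0 (1 / ((n : ℝ) + 1)) with hxs
    have hne : ∀ n, cylRadius (xs n) ≠ 0 := by
      intro n h0
      have h1 := ((cylRadius_eq_zero_iff _).1 h0).1
      have h2 : xs n 0 = 1 / ((n : ℝ) + 1) := by simp [hxs, hx.1]
      rw [h2] at h1
      exact absurd h1 (by positivity)
    have htend : Tendsto xs atTop (𝓝 x) := by
      rw [tendsto_iff_norm_sub_tendsto_zero]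
      have h : (fun n => ‖xs n - x‖) = fun n : ℕ => 1 / ((n : ℝ) + 1) := by
        funext n
        simp only [hxs, add_sub_cancel_left, PiLp.norm_single, Real.norm_eq_abs]
        exact abs_of_pos (by positivity)
      rw [h]
      exact tendsto_one_div_add_atTop_nhds_zero_nat
    have hlim : Tendsto (fun n => |angVortQuot v (xs n)|) atTop (𝓝 |angVortQuot v x|) :=
      ((continuous_abs.comp hcont).tendsto x).comp htend
    exact le_of_tendsto' hlim fun n => hoff _ (hne n)

/-! ### Member form -/

open DSSSwirlRatchet

variable {u : ℝ → EuclideanSpace ℝ (Fin 3) → EuclideanSpace ℝ (Fin 3)} {p : ℝ → EuclideanSpace ℝ (Fin 3) → ℝ}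
  {H : ℝ → EuclideanSpace ℝ (Fin 3) → EuclideanSpace ℝ (Fin 3) →L[ℝ] EuclideanSpace ℝ (Fin 3)} {c : ℝ≥0}

/-- **THE ONE-SLICE AXISYMMETRIC DSS STRATUM, VORTICITY-GRADIENT FORM.**  A classical axisymmetric `l`-DSS member of the class (`0 < ρ`, `l > 1`) with `u`/`∇u` bounded
on compact past intervals such that on ONE slice `τ₀ < 0` (swirl) `|r u_θ| ≤ B` ∨ `vol{r u_θ ≠ 0} < ⊤` ∨ `∫⁻ ofReal(|r u_θ|^q) < ⊤` for some `q > 0`, `qρ ≠ 3`, AND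
(vorticity gradient) `‖∇ω(τ₀, ·)‖ ≤ B₂`, is trivial: the swirl clause makes every slice swirl-free (`…DSSSwirlRatchet`, `…DSSSwirlCasimir`), then `|ω_θ/r| ≤ B₂` on the
slice `τ₀` (`abs_angVortQuot_le_of_norm_fderiv_curl_le`) is the bounded `η`-clause of `DSSEtaRatchet.ae_eq_zero_of_gauge_of_axisymNoSwirl_dss_eta`.
[cite: KochNadirashviliSereginSverak2009, §5 Remark 5.1; MajdaBertozziCUP2002, §4.3 eq. (4.60)] -/
theorem ae_eq_zero_of_gauge_of_axisym_dss_vorticityGradient {ρ : ℝ} (hρ : 0 < ρ)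
    (hH : HasWeakSpatialGradientOn (slab (EuclideanSpace ℝ (Fin 3)) (Iio 0) isOpen_Iio) u H)
    (hc : ∀ a : ℝ, 0 < a → ENNReal.ofReal (a ^ (2 * ρ)) * cknA a (0 : ℝ × EuclideanSpace ℝ (Fin 3)) u +
        ENNReal.ofReal (a ^ ρ) * cknE a (0 : ℝ × EuclideanSpace ℝ (Fin 3)) H +
        ENNReal.ofReal (a ^ (2 * ρ)) * cknD a (0 : ℝ × EuclideanSpace ℝ (Fin 3)) p ≤ (c : ℝ≥0∞))
    (hns : IsClassicalNSSolutionOn (Iio 0) 0 0 u p)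
    (hax : ∀ τ : ℝ, τ < 0 → IsAxisymmetric (u τ))
    {l : ℝ} (hl : 1 < l)
    (hdss : ∀ τ : ℝ, τ < 0 → ∀ y, u τ y = (l ^ (1 + ρ)) • u ((l ^ (2 + ρ)) * τ) (l • y))
    (hbdd : ∀ s t : ℝ, s < t → t < 0 → ∃ B : ℝ, ∀ τ ∈ Icc s t, ∀ y,
      ‖u τ y‖ ≤ B ∧ ‖fderiv ℝ (u τ) y‖ ≤ B)
    {τ₀ : ℝ} (hτ₀ : τ₀ < 0)
    (hswirl : (∃ B : ℝ, ∀ y, |swirl (u τ₀) y| ≤ B) ∨ volume {y : EuclideanSpace ℝ (Fin 3) | swirl (u τ₀) y ≠ 0} < ⊤ ∨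
      ∃ q : ℝ, 0 < q ∧ q * ρ ≠ 3 ∧ ∫⁻ y, ENNReal.ofReal (|swirl (u τ₀) y| ^ q) < ⊤)
    (hω : ∃ B₂ : ℝ, ∀ y, ‖fderiv ℝ (curl (u τ₀)) y‖ ≤ B₂) :
    uncurry u =ᵐ[volume.restrict (Iio (0 : ℝ) ×ˢ (univ : Set (EuclideanSpace ℝ (Fin 3))))] 0 := by
  have hL : ODE.IsUniformlyLipschitzOn u (Iio 0) := isUniformlyLipschitzOn_of_bounds hns hbdd
  have hsw : ∀ τ : ℝ, τ < 0 → HasNoSwirl (u τ) := by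
    rcases hswirl with ⟨B, hB⟩ | hfin | ⟨q, hq, hq3, hI⟩
    · exact hasNoSwirl_of_dss_of_bounded_swirl hρ hns hax hl hdss hbdd hτ₀ hB
    · exact hasNoSwirl_of_dss_of_finiteSwirlSupport hns hax hL hl hdss hτ₀ hfin
    · exact hasNoSwirl_of_dss_of_swirl_Lq hns hax hL hl hdss hτ₀ hq hq3 hI
  obtain ⟨B₂, hB₂⟩ := hω
  have hη : ∀ y, |angVortQuot (u τ₀) y| ≤ B₂ :=
    abs_angVortQuot_le_of_norm_fderiv_curl_le (hax τ₀ hτ₀) (hsw τ₀ hτ₀) ((hns.contDiff_velocity hτ₀).of_le (by norm_cast)) hB₂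
  exact ae_eq_zero_of_gauge_of_axisymNoSwirl_dss_eta hρ hH hc hns hax hsw hl hdss hbdd ⟨τ₀, hτ₀, Or.inl ⟨B₂, hη⟩⟩

end DSSEtaRatchet

end Summit.NavierStokesRegularity.NavierStokesRegularity.Theorems.PowerGaugeEulerLiouville

end
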